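import Mathlib
import HarnessLib
import Literature.Probability.Moments.BiasedCubeSharpThreshold
import Summits.PneNP.PneNP.Theses.WitnessForging

/-!
# Route WitnessForging — support item `LocalSamplersMissShatteredSets` (stmt-PneNP-2435): helper lemmas

Helper lemmas for `Summits/PneNP/PneNP/Theorems/WitnessForgingLocalSamplersMissShatteredSets.lean`
(the class-free NC⁰ rung `Summit.PneNP.PneNP.Theses.WitnessForging.LocalSamplersMissShatteredSets`):

* `sum_sq_sub_avg_le` — the Poincaré / Efron–Stein inequality on the discrete cube with the uniform
  measure, `Σ_x (g x − avg g)² ≤ ¼ Σ_k Σ_x (g(x^{k,1}) − g(x^{k,0}))²`, obtained from the tree theorem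
  `Literature.Probability.Moments.BiasedCube.var_le_sum_Ep_D_sq` at `p = 1/2`;
* `sum_powerset_sum_overwrite` — averaging over the `2^{|H|}` ways of overwriting a set `H` of
  coordinates ("conditioning on the heavy coins");
* `exists_weight_ge_total_sub` — the minimal-cut / greedy selection of one heavy weight;
* `min_card_preimage_mul_sq_le` — a low-sensitivity map cannot hit two well-separated targets both
  with substantial probability (Poincaré applied to `dist(·, A) − dist(·, B)`, then Chebyshev);
* `exists_cluster_ge` — the branch lemma: one cluster carries all but `2t` of the `S`-mass.

Finite sums only. References: B. Efron, C. Stein, Ann. Statist. 9 (1981); D. El Alaoui,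
A. Montanari, M. Sellke, FOCS 2022, §5 (the stability obstruction these lemmas discretise);
E. Viola, SIAM J. Comput. 41 (2012) (local samplers).
-/

namespace Summit.PneNP.PneNP.Theorems

open Finset Literature.Probability.Moments

/-- Under the uniform measure (`p = 1/2`) the biased-cube expectation `Ep` is the plain average.
[folklore] -/
theorem ep_half_eq_sum_div (m : ℕ) (f : (Fin m → Bool) → ℝ) :
    BiasedCube.Ep (1 / 2 : ℝ) f = (∑ x, f x) / 2 ^ m := by
  have hw : ∀ x : Fin m → Bool, BiasedCube.w (1 / 2 : ℝ) x = 1 / 2 ^ m := by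
    intro x
    unfold BiasedCube.w
    have h1 : ∀ i ∈ (Finset.univ : Finset (Fin m)), BiasedCube.wt (1 / 2 : ℝ) (x i) = 1 / 2 :=
      fun i _ => by unfold BiasedCube.wt; split_ifs <;> norm_num
    rw [Finset.prod_congr rfl h1, Finset.prod_const, Finset.card_univ, Fintype.card_fin, div_pow, one_pow]
  unfold BiasedCube.Ep
  simp only [hw, Finset.sum_div]
  refine Finset.sum_congr rfl fun x _ => ?_
  rw [one_div, inv_mul_eq_div]

/-- **Poincaré / Efron–Stein inequality on the discrete cube** (uniform measure, unnormalised):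
`Σ_x (g x − avg g)² ≤ ¼ Σ_k Σ_x (g(x^{k,1}) − g(x^{k,0}))²`. Specialisation at `p = 1/2` of the
tree theorem `BiasedCube.var_le_sum_Ep_D_sq`. [folklore] -/
theorem sum_sq_sub_avg_le (m : ℕ) (g : (Fin m → Bool) → ℝ) :
    ∑ x, (g x - (∑ y, g y) / 2 ^ m) ^ 2 ≤
      (1 / 4) * ∑ k : Fin m, ∑ x, (g (Function.update x k true) - g (Function.update x k false)) ^ 2 := by
  have h := BiasedCube.var_le_sum_Ep_D_sq (p := (1 / 2 : ℝ)) (by norm_num) (by norm_num) g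
  simp only [BiasedCube.Ep_D_sq, BiasedCube.sqDiff, ep_half_eq_sum_div] at h
  have h2 : (0 : ℝ) < 2 ^ m := by positivity
  rw [div_le_iff₀ h2, Finset.sum_mul] at h
  refine h.trans (le_of_eq ?_)
  rw [Finset.mul_sum]
  refine Finset.sum_congr rfl fun k _ => ?_
  rw [mul_assoc, div_mul_cancel₀ _ h2.ne']
  ring

/-- Averaging over one coordinate: `Σ_x φ x = ½ Σ_x (φ(x^{a,1}) + φ(x^{a,0}))`. [folklore] -/
theorem sum_eq_half_sum_update (m : ℕ) (a : Fin m) (φ : (Fin m → Bool) → ℝ) :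
    ∑ x, φ x = (1 / 2) * ∑ x, (φ (Function.update x a true) + φ (Function.update x a false)) := by
  have h := BiasedCube.Ep_eq_Ep_T_eMask (1 / 2 : ℝ) a φ
  rw [ep_half_eq_sum_div, ep_half_eq_sum_div, div_left_inj' (by positivity)] at h
  rw [h, Finset.mul_sum]
  refine Finset.sum_congr rfl fun x _ => by ring

/-- **Averaging over the branches of a set `H` of coordinates**: summing `φ` over the cube with the
`H`-coordinates overwritten by each of the `2^{|H|}` patterns `κ ⊆ H` gives `2^{|H|} Σ φ`.
[folklore] -/
theorem sum_powerset_sum_overwrite (m : ℕ) (H : Finset (Fin m)) (φ : (Fin m → Bool) → ℝ) :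
    ∑ κ ∈ H.powerset, ∑ r : Fin m → Bool, φ (fun j => if j ∈ H then decide (j ∈ κ) else r j) =
      2 ^ H.card * ∑ r, φ r := by
  induction H using Finset.induction_on with
  | empty => simp
  | insert a H haH ih =>
    rw [Finset.sum_powerset_insert haH, Finset.card_insert_of_notMem haH, pow_succ]
    have h1 : ∀ κ ∈ H.powerset, ∀ r : Fin m → Bool,
        (fun j => if j ∈ insert a H then decide (j ∈ κ) else r j) =
          (fun j => if j ∈ H then decide (j ∈ κ) else (Function.update r a false) j) := by
      intro κ hκ r
      have haκ : a ∉ κ := fun h => haH (Finset.mem_powerset.1 hκ h)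
      funext j
      by_cases hja : j = a
      · subst hja; simp [haH, haκ]
      · simp [Finset.mem_insert, hja]
    have h2 : ∀ κ ∈ H.powerset, ∀ r : Fin m → Bool,
        (fun j => if j ∈ insert a H then decide (j ∈ insert a κ) else r j) =
          (fun j => if j ∈ H then decide (j ∈ κ) else (Function.update r a true) j) := by
      intro κ _ r
      funext j
      by_cases hja : j = a
      · subst hja; simp [haH]
      · simp [Finset.mem_insert, hja]
    have h3 : ∀ κ ∈ H.powerset,
        ∑ r : Fin m → Bool, φ (fun j => if j ∈ insert a H then decide (j ∈ κ) else r j) +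
          ∑ r : Fin m → Bool, φ (fun j => if j ∈ insert a H then decide (j ∈ insert a κ) else r j) =
            2 * ∑ r : Fin m → Bool, φ (fun j => if j ∈ H then decide (j ∈ κ) else r j) := by
      intro κ hκ
      have e1 : ∑ r : Fin m → Bool, φ (fun j => if j ∈ insert a H then decide (j ∈ κ) else r j) =
          ∑ r : Fin m → Bool, φ (fun j => if j ∈ H then decide (j ∈ κ) else (Function.update r a false) j) :=
        Finset.sum_congr rfl fun r _ => by rw [h1 κ hκ r]
      have e2 : ∑ r : Fin m → Bool, φ (fun j => if j ∈ insert a H then decide (j ∈ insert a κ) else r j) =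
          ∑ r : Fin m → Bool, φ (fun j => if j ∈ H then decide (j ∈ κ) else (Function.update r a true) j) :=
        Finset.sum_congr rfl fun r _ => by rw [h2 κ hκ r]
      have e3 := sum_eq_half_sum_update m a (fun r => φ (fun j => if j ∈ H then decide (j ∈ κ) else r j))
      rw [e1, e2, e3, ← mul_assoc, show (2 : ℝ) * (1 / 2) = 1 by norm_num, one_mul, ← Finset.sum_add_distrib]
      exact Finset.sum_congr rfl fun r _ => add_comm _ _
    rw [← Finset.sum_add_distrib, Finset.sum_congr rfl h3, ← Finset.mul_sum, ih]
    ring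

/-- Among nonnegative weights `a_j` such that every bipartition `J ⊔ Jᶜ` has one side of total
weight `≤ t`, one single weight carries all but `2t` of the total (greedy / minimal-cut argument).
[folklore] -/
theorem exists_weight_ge_total_sub {N : ℕ} (a : Fin N → ℝ) (ha : ∀ j, 0 ≤ a j) (t : ℝ)
    (hbal : ∀ J : Finset (Fin N), min (∑ j ∈ J, a j) (∑ j ∈ Jᶜ, a j) ≤ t) (j₀ : Fin N) :
    ∃ j, ∑ i, a i - 2 * t ≤ a j := by
  have ht : 0 ≤ t := by
    have h := hbal ∅
    rw [Finset.sum_empty, min_eq_left (Finset.sum_nonneg fun j _ => ha j)] at h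
    exact h
  by_cases htot : ∑ i, a i ≤ 2 * t
  · exact ⟨j₀, by linarith [ha j₀]⟩
  push Not at htot
  obtain ⟨J, hJ, hmin⟩ := Finset.exists_min_image
    (Finset.univ.filter fun J : Finset (Fin N) => ∑ j ∈ Jᶜ, a j ≤ t) Finset.card
    ⟨Finset.univ, by simp [ht]⟩
  rw [Finset.mem_filter] at hJ
  have hJne : J.Nonempty := by
    rw [Finset.nonempty_iff_ne_empty]
    rintro rfl
    have h := hJ.2
    rw [Finset.compl_empty] at h
    linarith
  obtain ⟨j, hj⟩ := hJne
  refine ⟨j, ?_⟩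
  have hlt : ¬ (∑ i ∈ (J.erase j)ᶜ, a i ≤ t) := by
    intro h
    have h' := hmin (J.erase j) (by rw [Finset.mem_filter]; exact ⟨Finset.mem_univ _, h⟩)
    rw [Finset.card_erase_of_mem hj] at h'
    have := Finset.card_pos.2 ⟨j, hj⟩
    omega
  push Not at hlt
  have hsmall : ∑ i ∈ J.erase j, a i ≤ t := by
    have h := hbal (J.erase j)
    rcases min_le_iff.1 h with h | h
    · exact h
    · linarith
  have htot' : ∑ i, a i = a j + ∑ i ∈ J.erase j, a i + ∑ i ∈ Jᶜ, a i := by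
    rw [Finset.add_sum_erase _ _ hj, Finset.sum_add_sum_compl]
  linarith [hJ.2]

/-- Distance to a nonempty finite set is `1`-Lipschitz (for any "metric" satisfying the triangle
inequality). [folklore] -/
theorem inf'_le_add_inf' {α : Type*} (A : Finset α) (hA : A.Nonempty) (D : α → α → ℝ)
    (htri : ∀ x y z, D x z ≤ D x y + D y z) (x x' : α) :
    A.inf' hA (fun y => D x y) ≤ D x x' + A.inf' hA (fun y => D x' y) := by
  obtain ⟨y, hy, hyeq⟩ := Finset.exists_mem_eq_inf' hA (fun y => D x' y)
  rw [hyeq]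
  exact (Finset.inf'_le _ hy).trans (htri x x' y)


/-- **Well-separated targets cannot both be hit often by a low-sensitivity map.** If flipping input
bit `k` moves `G` by at most `d k` output bits (Hamming), and `A`, `B ⊆ {0,1}^n` are `s`-separated,
then `min(#G⁻¹A, #G⁻¹B) · s² ≤ 2^m Σ_k (d k)²`: Poincaré applied to
`g = dist(G x, A) − dist(G x, B)`, then Chebyshev on the side opposite to the mean of `g`.
[folklore; discrete form of the stability argument of El Alaoui–Montanari–Sellke 2022, §5] -/
theorem min_card_preimage_mul_sq_le (m n : ℕ) (G : (Fin m → Bool) → (Fin n → Bool)) (d : Fin m → ℝ)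
    (hd : ∀ k x, (hammingDist (G (Function.update x k true)) (G (Function.update x k false)) : ℝ) ≤ d k)
    (A B : Finset (Fin n → Bool)) (s : ℝ) (hs : 0 ≤ s)
    (hAB : ∀ a ∈ A, ∀ b ∈ B, s ≤ (hammingDist a b : ℝ)) :
    min (((Finset.univ.filter fun x => G x ∈ A).card : ℝ))
        (((Finset.univ.filter fun x => G x ∈ B).card : ℝ)) * s ^ 2 ≤ 2 ^ m * ∑ k, d k ^ 2 := by
  have hRHS : 0 ≤ (2 : ℝ) ^ m * ∑ k, d k ^ 2 := by positivity
  by_cases hA : A.Nonempty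
  swap
  · rw [Finset.not_nonempty_iff_eq_empty] at hA
    have h0 : ((Finset.univ.filter fun x => G x ∈ A).card : ℝ) = 0 := by
      rw [Nat.cast_eq_zero, Finset.card_eq_zero, Finset.filter_eq_empty_iff]
      simp [hA]
    rw [h0, min_eq_left (Nat.cast_nonneg _), zero_mul]
    exact hRHS
  by_cases hB : B.Nonempty
  swap
  · rw [Finset.not_nonempty_iff_eq_empty] at hB
    have h0 : ((Finset.univ.filter fun x => G x ∈ B).card : ℝ) = 0 := by
      rw [Nat.cast_eq_zero, Finset.card_eq_zero, Finset.filter_eq_empty_iff]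
      simp [hB]
    rw [h0, min_eq_right (Nat.cast_nonneg _), zero_mul]
    exact hRHS
  -- distance-to-cluster statistics
  obtain ⟨dA, hdA⟩ : ∃ dA : (Fin n → Bool) → ℝ, ∀ z, dA z = A.inf' hA fun y => (hammingDist z y : ℝ) :=
    ⟨_, fun z => rfl⟩
  obtain ⟨dB, hdB⟩ : ∃ dB : (Fin n → Bool) → ℝ, ∀ z, dB z = B.inf' hB fun y => (hammingDist z y : ℝ) :=
    ⟨_, fun z => rfl⟩
  have htri : ∀ x y z : Fin n → Bool, (hammingDist x z : ℝ) ≤ hammingDist x y + hammingDist y z :=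
    fun x y z => by exact_mod_cast hammingDist_triangle x y z
  have lipA : ∀ z z', dA z ≤ hammingDist z z' + dA z' := fun z z' => by
    rw [hdA, hdA]; exact inf'_le_add_inf' A hA (fun x y => (hammingDist x y : ℝ)) htri z z'
  have lipB : ∀ z z', dB z ≤ hammingDist z z' + dB z' := fun z z' => by
    rw [hdB, hdB]; exact inf'_le_add_inf' B hB (fun x y => (hammingDist x y : ℝ)) htri z z'
  obtain ⟨g, hg⟩ : ∃ g : (Fin m → Bool) → ℝ, ∀ x, g x = dA (G x) - dB (G x) := ⟨_, fun x => rfl⟩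
  -- gradient bound: flipping bit k moves g by at most 2 d k
  have hgrad : ∀ k x, (g (Function.update x k true) - g (Function.update x k false)) ^ 2 ≤ 4 * d k ^ 2 := by
    intro k x
    have h1 := hd k x
    have hsymm : (hammingDist (G (Function.update x k false)) (G (Function.update x k true)) : ℝ) =
        hammingDist (G (Function.update x k true)) (G (Function.update x k false)) := by
      rw [hammingDist_comm]
    have l1 := lipA (G (Function.update x k true)) (G (Function.update x k false))
    have l2 := lipA (G (Function.update x k false)) (G (Function.update x k true))
    have l3 := lipB (G (Function.update x k true)) (G (Function.update x k false))
    have l4 := lipB (G (Function.update x k false)) (G (Function.update x k true))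
    rw [hsymm] at l2 l4
    have habs : |g (Function.update x k true) - g (Function.update x k false)| ≤ 2 * d k := by
      rw [abs_le, hg, hg]
      constructor <;> linarith
    calc (g (Function.update x k true) - g (Function.update x k false)) ^ 2
        = |g (Function.update x k true) - g (Function.update x k false)| ^ 2 := (sq_abs _).symm
      _ ≤ (2 * d k) ^ 2 := pow_le_pow_left₀ (abs_nonneg _) habs 2
      _ = 4 * d k ^ 2 := by ring
  -- Poincaré inequality on the cube
  obtain ⟨μ, hμ⟩ : ∃ μ : ℝ, μ = (∑ y, g y) / 2 ^ m := ⟨_, rfl⟩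
  have hV : ∑ x, (g x - μ) ^ 2 ≤ 2 ^ m * ∑ k, d k ^ 2 := by
    rw [hμ]
    refine (sum_sq_sub_avg_le m g).trans ?_
    calc (1 / 4 : ℝ) * ∑ k : Fin m, ∑ x, (g (Function.update x k true) - g (Function.update x k false)) ^ 2
        ≤ (1 / 4) * ∑ k : Fin m, ∑ _x : Fin m → Bool, 4 * d k ^ 2 :=
          mul_le_mul_of_nonneg_left
            (Finset.sum_le_sum fun k _ => Finset.sum_le_sum fun x _ => hgrad k x) (by norm_num)
      _ = 2 ^ m * ∑ k, d k ^ 2 := by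
          simp only [Finset.sum_const, Finset.card_univ, Fintype.card_pi, Fintype.card_bool,
            Finset.prod_const, Fintype.card_fin, nsmul_eq_mul]
          push_cast
          rw [Finset.mul_sum, Finset.mul_sum]
          exact Finset.sum_congr rfl fun k _ => by ring
  -- values of g on the two preimages
  have hgA : ∀ x, G x ∈ A → g x ≤ -s := by
    intro x hx
    have h1 : dA (G x) ≤ 0 := by
      have := Finset.inf'_le (fun y => (hammingDist (G x) y : ℝ)) hx
      rw [hammingDist_self, Nat.cast_zero] at this
      rw [hdA]; exact this
    have h2 : s ≤ dB (G x) := by rw [hdB]; exact Finset.le_inf' _ _ fun b hb => hAB _ hx _ hb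
    rw [hg]; linarith
  have hgB : ∀ x, G x ∈ B → s ≤ g x := by
    intro x hx
    have h1 : dB (G x) ≤ 0 := by
      have := Finset.inf'_le (fun y => (hammingDist (G x) y : ℝ)) hx
      rw [hammingDist_self, Nat.cast_zero] at this
      rw [hdB]; exact this
    have h2 : s ≤ dA (G x) := by
      rw [hdA]
      exact Finset.le_inf' _ _ fun a ha => by rw [hammingDist_comm]; exact hAB _ ha _ hx
    rw [hg]; linarith
  -- Chebyshev on a side where `|g - μ| ≥ s`
  have key : ∀ (P : (Fin m → Bool) → Prop) [DecidablePred P], (∀ x, P x → s ≤ |g x - μ|) →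
      ((Finset.univ.filter P).card : ℝ) * s ^ 2 ≤ 2 ^ m * ∑ k, d k ^ 2 := by
    intro P _ hP
    calc ((Finset.univ.filter P).card : ℝ) * s ^ 2 = ∑ _x ∈ Finset.univ.filter P, s ^ 2 := by
          rw [Finset.sum_const, nsmul_eq_mul]
      _ ≤ ∑ x ∈ Finset.univ.filter P, (g x - μ) ^ 2 := Finset.sum_le_sum fun x hx => by
          rw [Finset.mem_filter] at hx
          calc s ^ 2 ≤ |g x - μ| ^ 2 := pow_le_pow_left₀ hs (hP x hx.2) 2
            _ = (g x - μ) ^ 2 := sq_abs _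
      _ ≤ ∑ x, (g x - μ) ^ 2 :=
          Finset.sum_le_sum_of_subset_of_nonneg (Finset.filter_subset _ _) fun _ _ _ => sq_nonneg _
      _ ≤ _ := hV
  rcases le_total 0 μ with hμ0 | hμ0
  · have h := key (fun x => G x ∈ A) fun x hx => by
      have := hgA x hx
      rw [abs_of_nonpos (by linarith)]; linarith
    calc _ ≤ ((Finset.univ.filter fun x => G x ∈ A).card : ℝ) * s ^ 2 :=
          mul_le_mul_of_nonneg_right (min_le_left _ _) (sq_nonneg _)
      _ ≤ _ := h
  · have h := key (fun x => G x ∈ B) fun x hx => by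
      have := hgB x hx
      rw [abs_of_nonneg (by linarith)]; linarith
    calc _ ≤ ((Finset.univ.filter fun x => G x ∈ B).card : ℝ) * s ^ 2 :=
          mul_le_mul_of_nonneg_right (min_le_right _ _) (sq_nonneg _)
      _ ≤ _ := h

/-- **Branch lemma.** For a map `G` of total squared sensitivity `2^m Σ (d k)² ≤ t s²` and a cover of
`S` by pairwise `s`-separated clusters `C j` (`s > 0`), one single cluster receives all but `2t` of
the mass that `G` puts on `S`. [folklore] -/
theorem exists_cluster_ge (m n N : ℕ) (G : (Fin m → Bool) → (Fin n → Bool)) (d : Fin m → ℝ)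
    (hd : ∀ k x, (hammingDist (G (Function.update x k true)) (G (Function.update x k false)) : ℝ) ≤ d k)
    (t s : ℝ) (hs : 0 < s) (ht : 2 ^ m * ∑ k, d k ^ 2 ≤ t * s ^ 2)
    (S : Finset (Fin n → Bool)) (C : Fin N → Finset (Fin n → Bool)) (j₀ : Fin N)
    (hcov : ∀ x ∈ S, ∃ j, x ∈ C j)
    (hsep : ∀ j j', j ≠ j' → ∀ x ∈ C j, ∀ y ∈ C j', s ≤ (hammingDist x y : ℝ)) :
    ∃ j, ((Finset.univ.filter fun x => G x ∈ S).card : ℝ) - 2 * t ≤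
      ((Finset.univ.filter fun x => G x ∈ C j).card : ℝ) := by
  -- clusters are pairwise disjoint
  have hdisj : ∀ j j', j ≠ j' → Disjoint (C j) (C j') := by
    intro j j' hjj'
    rw [Finset.disjoint_left]
    intro x hx hx'
    have := hsep j j' hjj' x hx x hx'
    rw [hammingDist_self, Nat.cast_zero] at this
    linarith
  obtain ⟨a, ha⟩ : ∃ a : Fin N → ℝ, ∀ j, a j = ((Finset.univ.filter fun x => G x ∈ C j).card : ℝ) :=
    ⟨_, fun j => rfl⟩
  have ha0 : ∀ j, 0 ≤ a j := fun j => by rw [ha]; exact Nat.cast_nonneg _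
  -- the mass of a union of clusters is the sum of the masses
  have hpre : ∀ J : Finset (Fin N), ∑ j ∈ J, a j =
      ((Finset.univ.filter fun x => G x ∈ J.biUnion C).card : ℝ) := by
    intro J
    have hset : (Finset.univ.filter fun x => G x ∈ J.biUnion C) =
        J.biUnion fun j => Finset.univ.filter fun x => G x ∈ C j := by
      ext x; simp [Finset.mem_biUnion]
    have hpd : (J : Set (Fin N)).PairwiseDisjoint fun j => Finset.univ.filter fun x => G x ∈ C j := by
      intro j _ j' _ hjj'
      exact Finset.disjoint_left.2 fun x hx hx' =>
        Finset.disjoint_left.1 (hdisj j j' hjj') (Finset.mem_filter.1 hx).2 (Finset.mem_filter.1 hx').2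
    rw [hset, Finset.card_biUnion hpd]
    push_cast
    exact Finset.sum_congr rfl fun j _ => ha j
  -- balance: every bipartition has a light side
  have hbal : ∀ J : Finset (Fin N), min (∑ j ∈ J, a j) (∑ j ∈ Jᶜ, a j) ≤ t := by
    intro J
    rw [hpre J, hpre Jᶜ]
    have hsepJ : ∀ a' ∈ J.biUnion C, ∀ b' ∈ Jᶜ.biUnion C, s ≤ (hammingDist a' b' : ℝ) := by
      intro a' ha' b' hb'
      rw [Finset.mem_biUnion] at ha' hb'
      obtain ⟨j, hj, hja⟩ := ha'
      obtain ⟨j', hj', hjb⟩ := hb'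
      have hne : j ≠ j' := fun h => (Finset.mem_compl.1 hj') (h ▸ hj)
      exact hsep j j' hne a' hja b' hjb
    have h := min_card_preimage_mul_sq_le m n G d hd (J.biUnion C) (Jᶜ.biUnion C) s hs.le hsepJ
    exact le_of_mul_le_mul_right (h.trans ht) (by positivity)
  obtain ⟨j, hj⟩ := exists_weight_ge_total_sub a ha0 t hbal j₀
  refine ⟨j, le_trans ?_ ((ha j) ▸ hj)⟩
  -- the `S`-mass is at most the total cluster mass
  have h1 : (Finset.univ.filter fun x => G x ∈ S) ⊆
      (Finset.univ : Finset (Fin N)).biUnion fun j => Finset.univ.filter fun x => G x ∈ C j := by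
    intro x hx
    rw [Finset.mem_filter] at hx
    obtain ⟨j, hj⟩ := hcov _ hx.2
    exact Finset.mem_biUnion.2 ⟨j, Finset.mem_univ _, Finset.mem_filter.2 ⟨Finset.mem_univ _, hj⟩⟩
  have h2 : ((Finset.univ.filter fun x => G x ∈ S).card : ℝ) ≤ ∑ i, a i := by
    calc ((Finset.univ.filter fun x => G x ∈ S).card : ℝ)
        ≤ ((((Finset.univ : Finset (Fin N)).biUnion fun j =>
            Finset.univ.filter fun x => G x ∈ C j).card : ℕ) : ℝ) := by
          exact_mod_cast Finset.card_le_card h1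
      _ ≤ ((∑ i : Fin N, (Finset.univ.filter fun x => G x ∈ C i).card : ℕ) : ℝ) := by
          exact_mod_cast Finset.card_biUnion_le
      _ = ∑ i, a i := by push_cast; exact Finset.sum_congr rfl fun i _ => (ha i).symm
  linarith

end Summit.PneNP.PneNP.Theorems
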